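import Mathlib

/-!
# Crux `NewtonTauWeak` (stmt-ValiantsHypothesis-5904), line `landing-collapse`: the RUNG `CappedSlopeSum`
(landing collapse on the grid — slope-height counting)

The line `Cruxes/NewtonTauWeak/Lines/landing_collapse.lean` (val-idea-12 g0) registers the rung
`stub_cappedSlopeSumRung : CappedSlopeSum`: for `≤ n²` non-vertical real lines `y = s·x + c` (`(s, c) ∈ Λ`), the number
of LANDINGS — pairs (slope, covered point of the grid `[n]² = range n × range n`), capped at `n` per slope — is
`≤ C (n+2)^{7/3}`.  In the coordinates `(x, y - x²)` this is the count of convex-position points produced by the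
Farey–parabola mechanism (`Theorems/…BlockConvexFarey.lean`, `farey_parabola_main`, p593702), which shows the exponent
`7/3` is attained; so the rung is tight.  This file PROVES it, with `C = 5`, statement written out verbatim over
tree-visible constants (no new `Prop` definitions).

Proof (pure grid counting, [BBFKOTT10, §5] mechanism; [folklore]):
* `card_le_of_pairwise_dvd_sub` — naturals `< n` pairwise congruent mod `d ≥ 1` number `≤ (n-1)/d + 1`;
* `sub_mul_den_eq` — two grid points on a line of rational slope `q` satisfy `Δy · den q = num q · Δx`, whence
  `den q ∣ Δx` and `num q ∣ Δy` (reduced fraction);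
* `card_linePts_le` — a line whose slope is NOT a fraction `a/b` with `|a|, b ≤ H` meets the grid in
  `≤ (n-1)/(H+1) + 1` points (irrational slope: `≤ 1` point; else project to the `x`- or `y`-coordinate, a residue class
  mod `den q ≥ H+1` or mod `|num q| ≥ H+1`);
* `sum_capped_le` — split the slopes at height `H`: the `≤ (2H+1)·H` low slopes contribute `≤ n` each, the high slopes
  contribute `≤ #(lines of that slope) · ((n-1)/(H+1) + 1)`, summing to `≤ n² ((n-1)/(H+1) + 1)`;
* `cappedSlopeSum_bound` — with `H = ⌊(n+2)^{2/3}⌋` the total is `≤ 5 (n+2)^{7/3}`; `stub_cappedSlopeSumRung` is the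
  registered `∃ C` form.

This is the rung / witness of the line's mechanism only: it is NOT consumed by the line's composition, and nothing here
bears on `ThreeSetBound`, `BlockConvexBound`, the crux `NewtonTauWeak`, or `VP ≠ VNP`.  Helper for the crux item
(`--supports`).
-/

set_option linter.dupNamespace false

namespace Summit.ValiantsHypothesis.ValiantsHypothesis.Theorems.NewtonFramesNewtonTauWeak.CappedSlopeSum

open scoped BigOperators

noncomputable section

/-! ### 1. Residue classes and reduced fractions -/

/-- A finite set of naturals below `n`, pairwise congruent modulo `d`, has at most `(n-1)/d + 1` elements
(`b ↦ b / d` is injective on it, into `range ((n-1)/d + 1)`; for `d = 0` the set has at most one element and Lean's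
`x / 0 = 0` makes the bound `1`). [folklore] -/
theorem card_le_of_pairwise_dvd_sub (B : Finset ℕ) (n d : ℕ) (hB : ∀ b ∈ B, b < n)
    (hmod : ∀ b ∈ B, ∀ b' ∈ B, (d : ℤ) ∣ (b : ℤ) - (b' : ℤ)) : B.card ≤ (n - 1) / d + 1 := by
  have hmaps : Set.MapsTo (fun b => b / d) (B : Set ℕ) (Finset.range ((n - 1) / d + 1) : Set ℕ) := by
    intro b hb
    have hbn := hB b hb
    simp only [Finset.coe_range, Set.mem_Iio]
    exact Nat.lt_succ_of_le (Nat.div_le_div_right (by omega))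
  have hinj : Set.InjOn (fun b => b / d) (B : Set ℕ) := by
    intro b hb b' hb' h
    have h1 : b % d = b' % d := by
      have hme : b ≡ b' [MOD d] := (Nat.modEq_iff_dvd).mpr (hmod b' hb' b hb)
      exact hme
    simp only at h
    calc b = d * (b / d) + b % d := (Nat.div_add_mod b d).symm
      _ = d * (b' / d) + b' % d := by rw [h, h1]
      _ = b' := Nat.div_add_mod b' d
  calc B.card ≤ (Finset.range ((n - 1) / d + 1)).card := Finset.card_le_card_of_injOn _ hmaps hinj
    _ = (n - 1) / d + 1 := Finset.card_range _

/-- Two natural points `x, x'` on a real line `y = s·x + c` of RATIONAL slope `s = q` satisfy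
`(x.2 - x'.2) · den q = num q · (x.1 - x'.1)` in `ℤ`. [folklore] -/
theorem sub_mul_den_eq {s c : ℝ} {q : ℚ} (hq : (q : ℝ) = s) {x x' : ℕ × ℕ}
    (hx : (x.2 : ℝ) = s * x.1 + c) (hx' : (x'.2 : ℝ) = s * x'.1 + c) :
    ((x.2 : ℤ) - x'.2) * q.den = q.num * ((x.1 : ℤ) - x'.1) := by
  have h1 : (((x.2 : ℚ) - x'.2 : ℚ) : ℝ) = ((q * ((x.1 : ℚ) - x'.1) : ℚ) : ℝ) := by
    push_cast
    rw [hq]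
    linear_combination hx - hx'
  have h2 : ((x.2 : ℚ) - x'.2) = q * ((x.1 : ℚ) - x'.1) := by exact_mod_cast h1
  have h3 : ((((x.2 : ℤ) - x'.2) * q.den : ℤ) : ℚ) = ((q.num * ((x.1 : ℤ) - x'.1) : ℤ) : ℚ) := by
    push_cast
    rw [h2]
    linear_combination ((x.1 : ℚ) - x'.1) * Rat.mul_den_eq_num q
  exact_mod_cast h3

/-! ### 2. Grid points on one line of large height -/

/-- **Per-line count.**  Let `A` be a finite set of points of the grid `[0,n)²` on the real line `y = s·x + c`, and
suppose the slope `s` is not a fraction `a/b` with `|a| ≤ H`, `b ≤ H`.  Then `#A ≤ (n-1)/(H+1) + 1`: an irrational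
slope carries at most one lattice point; a rational slope `q` with `den q ≥ H+1` has its points in one residue class of
abscissae mod `den q`, and one with `|num q| ≥ H+1` in one residue class of ordinates mod `|num q|`. [folklore] -/
theorem card_linePts_le (n H : ℕ) (s c : ℝ) (A : Finset (ℕ × ℕ))
    (hA : ∀ x ∈ A, x.1 < n ∧ x.2 < n ∧ (x.2 : ℝ) = s * x.1 + c)
    (hs : ∀ q : ℚ, (q : ℝ) = s → ¬ (|q.num| ≤ H ∧ q.den ≤ H)) :
    A.card ≤ (n - 1) / (H + 1) + 1 := by
  classical
  by_cases hrat : ∃ q : ℚ, (q : ℝ) = s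
  · obtain ⟨q, hq⟩ := hrat
    have hqs := hs q hq
    have hdiv : ∀ x ∈ A, ∀ x' ∈ A, ((x.2 : ℤ) - x'.2) * q.den = q.num * ((x.1 : ℤ) - x'.1) :=
      fun x hx x' hx' => sub_mul_den_eq hq (hA x hx).2.2 (hA x' hx').2.2
    have hcop : IsCoprime q.num (q.den : ℤ) := Int.isCoprime_iff_gcd_eq_one.mpr q.reduced
    by_cases hden : H < q.den
    · -- project to the abscissa: a residue class mod `den q ≥ H + 1`
      have hinj : Set.InjOn Prod.fst (A : Set (ℕ × ℕ)) := by
        intro x hx x' hx' h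
        have h2 := (hA x hx).2.2
        have h2' := (hA x' hx').2.2
        refine Prod.ext h ?_
        have : (x.2 : ℝ) = x'.2 := by rw [h2, h2', h]
        exact_mod_cast this
      rw [← Finset.card_image_of_injOn hinj]
      refine (card_le_of_pairwise_dvd_sub (A.image Prod.fst) n q.den ?_ ?_).trans ?_
      · intro b hb
        obtain ⟨x, hx, rfl⟩ := Finset.mem_image.mp hb
        exact (hA x hx).1
      · intro b hb b' hb'
        obtain ⟨x, hx, rfl⟩ := Finset.mem_image.mp hb
        obtain ⟨x', hx', rfl⟩ := Finset.mem_image.mp hb'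
        exact hcop.symm.dvd_of_dvd_mul_left ⟨(x.2 : ℤ) - x'.2, by rw [← hdiv x hx x' hx', mul_comm]⟩
      · exact Nat.add_le_add_right (Nat.div_le_div_left (by omega) (by omega)) 1
    · -- `den q ≤ H`, so `|num q| ≥ H + 1`: project to the ordinate
      have hnum : (H : ℤ) < |q.num| := by
        by_contra hle
        push Not at hle
        exact hqs ⟨hle, by omega⟩
      have hnum0 : q.num ≠ 0 := by
        have : (0 : ℤ) < |q.num| := lt_of_le_of_lt (by positivity) hnum
        exact abs_pos.mp this
      have hq0 : q ≠ 0 := Rat.num_ne_zero.mp hnum0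
      have hs0 : s ≠ 0 := by
        rw [← hq]
        exact_mod_cast hq0
      have hinj : Set.InjOn Prod.snd (A : Set (ℕ × ℕ)) := by
        intro x hx x' hx' h
        have h2 := (hA x hx).2.2
        have h2' := (hA x' hx').2.2
        refine Prod.ext ?_ h
        have hy : (x.2 : ℝ) = x'.2 := by exact_mod_cast h
        have hsx : s * (x.1 : ℝ) = s * x'.1 := by linarith
        have := mul_left_cancel₀ hs0 hsx
        exact_mod_cast this
      rw [← Finset.card_image_of_injOn hinj]
      set d := q.num.natAbs with hd
      have hdH : H + 1 ≤ d := by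
        have : (H : ℤ) < (d : ℤ) := by rw [hd, Int.natCast_natAbs]; exact hnum
        omega
      refine (card_le_of_pairwise_dvd_sub (A.image Prod.snd) n d ?_ ?_).trans ?_
      · intro b hb
        obtain ⟨x, hx, rfl⟩ := Finset.mem_image.mp hb
        exact (hA x hx).2.1
      · intro b hb b' hb'
        obtain ⟨x, hx, rfl⟩ := Finset.mem_image.mp hb
        obtain ⟨x', hx', rfl⟩ := Finset.mem_image.mp hb'
        have h1 : q.num ∣ ((x.2 : ℤ) - x'.2) * q.den := ⟨(x.1 : ℤ) - x'.1, hdiv x hx x' hx'⟩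
        have h2 : q.num ∣ (x.2 : ℤ) - x'.2 := hcop.dvd_of_dvd_mul_right h1
        rw [hd]
        exact Int.natAbs_dvd.mpr h2
      · exact Nat.add_le_add_right (Nat.div_le_div_left hdH (by omega)) 1
  · -- irrational slope: at most one lattice point
    have h1 : A.card ≤ 1 := by
      refine Finset.card_le_one.mpr fun x hx x' hx' => ?_
      by_contra hne
      have h2 := (hA x hx).2.2
      have h2' := (hA x' hx').2.2
      have hx1 : x.1 ≠ x'.1 := by
        intro h
        apply hne
        refine Prod.ext h ?_
        have : (x.2 : ℝ) = x'.2 := by rw [h2, h2', h]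
        exact_mod_cast this
      apply hrat
      refine ⟨((x.2 : ℚ) - x'.2) / ((x.1 : ℚ) - x'.1), ?_⟩
      have hne' : ((x.1 : ℝ) - x'.1) ≠ 0 := by
        rw [sub_ne_zero]
        exact_mod_cast hx1
      push_cast
      rw [div_eq_iff hne']
      linear_combination h2 - h2'
    calc A.card ≤ 1 := h1
      _ ≤ (n - 1) / (H + 1) + 1 := Nat.le_add_left 1 _

/-! ### 3. Low slopes -/

/-- A rational `q` with `|num q| ≤ H` and `den q ≤ H` lies in the finite set of "low slopes"
`{(a - H)/(b + 1) : a < 2H+1, b < H}` (take `a = num q + H`, `b = den q - 1`). [folklore] -/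
theorem mem_lowSlopes (H : ℕ) (q : ℚ) (hnum : |q.num| ≤ H) (hden : q.den ≤ H) :
    (q : ℝ) ∈ ((Finset.range (2 * H + 1)) ×ˢ (Finset.range H)).image
      (fun p : ℕ × ℕ => ((p.1 : ℝ) - H) / ((p.2 : ℝ) + 1)) := by
  rw [Finset.mem_image]
  have habs := abs_le.mp hnum
  have h0 : 0 ≤ q.num + H := by omega
  have hden1 : 1 ≤ q.den := q.den_pos
  refine ⟨((q.num + H).toNat, q.den - 1), ?_, ?_⟩
  · rw [Finset.mem_product, Finset.mem_range, Finset.mem_range]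
    have ht : (((q.num + H).toNat : ℕ) : ℤ) = q.num + H := Int.toNat_of_nonneg h0
    constructor
    · omega
    · omega
  · have ht : (((q.num + H).toNat : ℕ) : ℝ) = (q.num : ℝ) + H := by
      have := Int.toNat_of_nonneg h0
      exact_mod_cast this
    have hd : (((q.den - 1 : ℕ) : ℝ) + 1) = (q.den : ℝ) := by
      have : ((q.den - 1 + 1 : ℕ) : ℝ) = (q.den : ℝ) := by rw [Nat.sub_add_cancel hden1]
      push_cast [Nat.cast_sub hden1] at this ⊢
      linarith
    simp only
    rw [ht, hd, add_sub_cancel_right, Rat.cast_def]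

/-! ### 4. The capped count -/

open Classical in
/-- **Per-slope count for a high slope.**  If `s` is not a low slope (no fraction `a/b` with `|a|, b ≤ H`), the grid
points of `[0,n)²` covered by the lines of `Λ` of slope `s` number at most `#{l ∈ Λ : l.1 = s} · ((n-1)/(H+1) + 1)`
(union over those lines of `card_linePts_le`). [folklore] -/
theorem card_cov_le (n H : ℕ) (Λ : Finset (ℝ × ℝ)) (s : ℝ)
    (hs : ∀ q : ℚ, (q : ℝ) = s → ¬ (|q.num| ≤ H ∧ q.den ≤ H)) :
    (((Finset.range n) ×ˢ (Finset.range n)).filter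
        (fun x : ℕ × ℕ => ∃ l ∈ Λ, l.1 = s ∧ (x.2 : ℝ) = s * (x.1 : ℝ) + l.2)).card ≤
      (Λ.filter (fun l => l.1 = s)).card * ((n - 1) / (H + 1) + 1) := by
  classical
  set pts : ℝ × ℝ → Finset (ℕ × ℕ) := fun l =>
    ((Finset.range n) ×ˢ (Finset.range n)).filter (fun x : ℕ × ℕ => (x.2 : ℝ) = l.1 * (x.1 : ℝ) + l.2)
    with hpts
  have hsub : (((Finset.range n) ×ˢ (Finset.range n)).filter
        (fun x : ℕ × ℕ => ∃ l ∈ Λ, l.1 = s ∧ (x.2 : ℝ) = s * (x.1 : ℝ) + l.2)) ⊆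
      (Λ.filter (fun l => l.1 = s)).biUnion pts := by
    intro x hx
    rw [Finset.mem_filter] at hx
    obtain ⟨hgrid, l, hl, hl1, hx2⟩ := hx
    rw [Finset.mem_biUnion]
    refine ⟨l, Finset.mem_filter.mpr ⟨hl, hl1⟩, ?_⟩
    rw [hpts, Finset.mem_filter]
    exact ⟨hgrid, by rw [hl1]; exact hx2⟩
  calc _ ≤ ((Λ.filter (fun l => l.1 = s)).biUnion pts).card := Finset.card_le_card hsub
    _ ≤ ∑ l ∈ Λ.filter (fun l => l.1 = s), (pts l).card := Finset.card_biUnion_le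
    _ ≤ ∑ _l ∈ Λ.filter (fun l => l.1 = s), ((n - 1) / (H + 1) + 1) := by
        refine Finset.sum_le_sum fun l hl => ?_
        have hl1 : l.1 = s := (Finset.mem_filter.mp hl).2
        refine card_linePts_le n H s l.2 (pts l) (fun x hx => ?_) hs
        rw [hpts, Finset.mem_filter, Finset.mem_product, Finset.mem_range, Finset.mem_range] at hx
        exact ⟨hx.1.1, hx.1.2, by rw [← hl1]; exact hx.2⟩
    _ = _ := by rw [Finset.sum_const, smul_eq_mul]

open Classical in
/-- **The capped count, combinatorial form.**  For every height threshold `H` and every `Λ` with `#Λ ≤ n²`: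
`Σ_{s} min(n, #covered_s) ≤ n · (2H+1)·H + n² · ((n-1)/(H+1) + 1)` — low slopes (fractions `a/b`, `|a|, b ≤ H`, at
most `(2H+1)·H` of them) are capped at `n` each; a high slope contributes `#covered_s ≤ #Λ_s · ((n-1)/(H+1) + 1)` and
`Σ_s #Λ_s = #Λ ≤ n²`. [folklore] -/
theorem sum_capped_le (n H : ℕ) (Λ : Finset (ℝ × ℝ)) (hΛ : Λ.card ≤ n ^ 2) :
    (∑ s ∈ Λ.image Prod.fst,
        min n (((Finset.range n) ×ˢ (Finset.range n)).filter
          (fun x : ℕ × ℕ => ∃ l ∈ Λ, l.1 = s ∧ (x.2 : ℝ) = s * (x.1 : ℝ) + l.2)).card) ≤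
      n * ((2 * H + 1) * H) + n ^ 2 * ((n - 1) / (H + 1) + 1) := by
  classical
  set G : Finset ℝ := ((Finset.range (2 * H + 1)) ×ˢ (Finset.range H)).image
    (fun p : ℕ × ℕ => ((p.1 : ℝ) - H) / ((p.2 : ℝ) + 1)) with hG
  set F : ℝ → ℕ := fun s => min n (((Finset.range n) ×ˢ (Finset.range n)).filter
      (fun x : ℕ × ℕ => ∃ l ∈ Λ, l.1 = s ∧ (x.2 : ℝ) = s * (x.1 : ℝ) + l.2)).card with hF
  have hsplit := (Finset.sum_filter_add_sum_filter_not (Λ.image Prod.fst) (fun s => s ∈ G) F).symm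
  -- low slopes: capped at `n` each
  have hlow : ∑ s ∈ (Λ.image Prod.fst).filter (fun s => s ∈ G), F s ≤ n * ((2 * H + 1) * H) := by
    calc ∑ s ∈ (Λ.image Prod.fst).filter (fun s => s ∈ G), F s
        ≤ ∑ _s ∈ (Λ.image Prod.fst).filter (fun s => s ∈ G), n :=
          Finset.sum_le_sum fun s _ => by rw [hF]; exact min_le_left _ _
      _ = ((Λ.image Prod.fst).filter (fun s => s ∈ G)).card * n := by rw [Finset.sum_const, smul_eq_mul]
      _ ≤ G.card * n := by
          gcongr
          exact fun s hs => (Finset.mem_filter.mp hs).2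
      _ ≤ ((Finset.range (2 * H + 1)) ×ˢ (Finset.range H)).card * n := by
          gcongr
          exact Finset.card_image_le
      _ = n * ((2 * H + 1) * H) := by
          rw [Finset.card_product, Finset.card_range, Finset.card_range]; ring
  -- high slopes: per-line count, then sum over the fibres of `Prod.fst`
  have hhigh : ∑ s ∈ (Λ.image Prod.fst).filter (fun s => ¬ s ∈ G), F s ≤
      n ^ 2 * ((n - 1) / (H + 1) + 1) := by
    calc ∑ s ∈ (Λ.image Prod.fst).filter (fun s => ¬ s ∈ G), F s
        ≤ ∑ s ∈ (Λ.image Prod.fst).filter (fun s => ¬ s ∈ G),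
            (Λ.filter (fun l => l.1 = s)).card * ((n - 1) / (H + 1) + 1) := by
          refine Finset.sum_le_sum fun s hs => ?_
          have hsG : s ∉ G := (Finset.mem_filter.mp hs).2
          rw [hF]
          refine (min_le_right _ _).trans (card_cov_le n H Λ s fun q hq hqH => hsG ?_)
          rw [← hq]
          exact mem_lowSlopes H q hqH.1 hqH.2
      _ ≤ ∑ s ∈ Λ.image Prod.fst, (Λ.filter (fun l => l.1 = s)).card * ((n - 1) / (H + 1) + 1) :=
          Finset.sum_le_sum_of_subset (Finset.filter_subset _ _)
      _ = ∑ s ∈ Λ.image Prod.fst, ∑ _l ∈ Λ.filter (fun l => l.1 = s), ((n - 1) / (H + 1) + 1) := by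
          refine Finset.sum_congr rfl fun s _ => ?_
          rw [Finset.sum_const, smul_eq_mul]
      _ = ∑ _l ∈ Λ, ((n - 1) / (H + 1) + 1) :=
          Finset.sum_fiberwise_of_maps_to (fun l hl => Finset.mem_image_of_mem Prod.fst hl) _
      _ = Λ.card * ((n - 1) / (H + 1) + 1) := by rw [Finset.sum_const, smul_eq_mul]
      _ ≤ n ^ 2 * ((n - 1) / (H + 1) + 1) := Nat.mul_le_mul_right _ hΛ
  rw [hsplit]
  exact Nat.add_le_add hlow hhigh

/-! ### 5. The rung -/

open Classical in
/-- **`CappedSlopeSum` with the explicit constant `C = 5`.**  For `#Λ ≤ n²` the capped slope sum is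
`≤ 5 (n+2)^{7/3}`: take `H = ⌊(n+2)^{2/3}⌋` in `sum_capped_le`; with `X = n+2`, `Y = X^{2/3}` (`Y³ = X²`,
`1 ≤ Y ≤ X ≤ Y²`) the low part is `≤ n (2H+1) H ≤ 3 X Y²` and the high part is `≤ n² (n/Y + 1) ≤ 2 X Y²`, while
`X Y² = X^{7/3}`. [folklore] -/
theorem cappedSlopeSum_bound (n : ℕ) (Λ : Finset (ℝ × ℝ)) (hΛ : Λ.card ≤ n ^ 2) :
    (∑ s ∈ Λ.image Prod.fst,
        (min n (((Finset.range n) ×ˢ (Finset.range n)).filter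
          (fun x : ℕ × ℕ => ∃ l ∈ Λ, l.1 = s ∧ (x.2 : ℝ) = s * (x.1 : ℝ) + l.2)).card : ℝ)) ≤
      5 * ((n : ℝ) + 2) ^ ((7 : ℝ) / 3) := by
  classical
  set X : ℝ := (n : ℝ) + 2 with hX
  set Y : ℝ := X ^ ((2 : ℝ) / 3) with hY
  set H : ℕ := ⌊Y⌋₊ with hH
  set D : ℕ := (n - 1) / (H + 1) with hD
  have hn0 : (0 : ℝ) ≤ n := Nat.cast_nonneg _
  have hX1 : (1 : ℝ) ≤ X := by rw [hX]; linarith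
  have hX0 : (0 : ℝ) ≤ X := by linarith
  have hXpos : (0 : ℝ) < X := by linarith
  have hnX : (n : ℝ) ≤ X := by rw [hX]; linarith
  have hY1 : (1 : ℝ) ≤ Y := Real.one_le_rpow hX1 (by norm_num)
  have hY0 : (0 : ℝ) ≤ Y := by linarith
  have hYpos : (0 : ℝ) < Y := by linarith
  have hHY : (H : ℝ) ≤ Y := Nat.floor_le hY0
  have hYH : Y < (H : ℝ) + 1 := Nat.lt_floor_add_one Y
  have hH0 : (0 : ℝ) ≤ H := Nat.cast_nonneg _
  have hY3 : Y ^ 3 = X ^ 2 := by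
    rw [hY, ← Real.rpow_natCast, ← Real.rpow_mul hX0]
    norm_num
  have hY2 : Y ^ 2 = X ^ ((4 : ℝ) / 3) := by
    rw [hY, ← Real.rpow_natCast, ← Real.rpow_mul hX0]
    norm_num
  have hYX : Y ≤ X := by
    rw [hY]
    calc X ^ ((2 : ℝ) / 3) ≤ X ^ (1 : ℝ) := Real.rpow_le_rpow_of_exponent_le hX1 (by norm_num)
      _ = X := Real.rpow_one X
  have hXY2 : X ≤ Y ^ 2 := by
    rw [hY2]
    calc X = X ^ (1 : ℝ) := (Real.rpow_one X).symm
      _ ≤ X ^ ((4 : ℝ) / 3) := Real.rpow_le_rpow_of_exponent_le hX1 (by norm_num)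
  have h73 : X ^ ((7 : ℝ) / 3) = X * Y ^ 2 := by
    rw [hY2, show (7 : ℝ) / 3 = 1 + 4 / 3 by norm_num, Real.rpow_add hXpos, Real.rpow_one]
  -- the combinatorial bound, cast to `ℝ`
  have hnat := sum_capped_le n H Λ hΛ
  rw [← hD] at hnat
  have hcast : (∑ s ∈ Λ.image Prod.fst,
        (min n (((Finset.range n) ×ˢ (Finset.range n)).filter
          (fun x : ℕ × ℕ => ∃ l ∈ Λ, l.1 = s ∧ (x.2 : ℝ) = s * (x.1 : ℝ) + l.2)).card : ℝ)) ≤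
      (n : ℝ) * ((2 * H + 1) * H) + (n : ℝ) ^ 2 * ((D : ℝ) + 1) := by
    have := (Nat.cast_le (α := ℝ)).mpr hnat
    push_cast at this
    exact this
  -- `D · Y ≤ n`
  have hDY : (D : ℝ) * Y ≤ n := by
    have h1 : D * (H + 1) ≤ n := by
      have := Nat.div_mul_le_self (n - 1) (H + 1)
      rw [← hD] at this
      omega
    have h2 : (D : ℝ) * ((H : ℝ) + 1) ≤ n := by exact_mod_cast h1
    have hD0 : (0 : ℝ) ≤ D := Nat.cast_nonneg _
    nlinarith
  -- low part
  have hlow : (n : ℝ) * ((2 * H + 1) * H) ≤ 3 * X * Y ^ 2 := by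
    have h1 : (2 * (H : ℝ) + 1) * H ≤ (2 * Y + 1) * Y :=
      mul_le_mul (by linarith) hHY hH0 (by positivity)
    have h2 : (2 * Y + 1) * Y ≤ 3 * Y * Y := mul_le_mul_of_nonneg_right (by linarith) hY0
    calc (n : ℝ) * ((2 * H + 1) * H) ≤ X * (3 * Y * Y) := mul_le_mul hnX (h1.trans h2) (by positivity) hX0
      _ = 3 * X * Y ^ 2 := by ring
  -- high part
  have hhigh : (n : ℝ) ^ 2 * ((D : ℝ) + 1) ≤ 2 * X * Y ^ 2 := by
    have hn2 : (n : ℝ) ^ 2 ≤ X ^ 2 := pow_le_pow_left₀ hn0 hnX 2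
    have hA : (n : ℝ) ^ 2 * ((D : ℝ) * Y) ≤ X ^ 2 * X :=
      mul_le_mul hn2 (hDY.trans hnX) (by positivity) (by positivity)
    have hB : (n : ℝ) ^ 2 * Y ≤ X ^ 2 * X := mul_le_mul hn2 hYX hY0 (by positivity)
    have hC : (n : ℝ) ^ 2 * ((D : ℝ) + 1) * Y ≤ 2 * X * Y ^ 2 * Y := by
      calc (n : ℝ) ^ 2 * ((D : ℝ) + 1) * Y = (n : ℝ) ^ 2 * ((D : ℝ) * Y) + (n : ℝ) ^ 2 * Y := by ring
        _ ≤ X ^ 2 * X + X ^ 2 * X := add_le_add hA hB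
        _ = 2 * X * Y ^ 3 := by rw [hY3]; ring
        _ = 2 * X * Y ^ 2 * Y := by ring
    exact le_of_mul_le_mul_right hC hYpos
  calc _ ≤ (n : ℝ) * ((2 * H + 1) * H) + (n : ℝ) ^ 2 * ((D : ℝ) + 1) := hcast
    _ ≤ 3 * X * Y ^ 2 + 2 * X * Y ^ 2 := add_le_add hlow hhigh
    _ = 5 * X ^ ((7 : ℝ) / 3) := by rw [h73]; ring

open Classical in
/-- **THE RUNG `CappedSlopeSum` of line `landing-collapse` (`stub_cappedSlopeSumRung`), verbatim:** there is `C` such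
that for all `n` and all `Λ` with `#Λ ≤ n²`, the slope-height landing count on the grid, capped at `n` per slope, is
`≤ C (n+2)^{7/3}` (`C = 5`, `cappedSlopeSum_bound`).  Tight: `BlockConvexFarey.farey_parabola_main` realises
`n^{7/3}/8`. [folklore] -/
theorem stub_cappedSlopeSumRung :
    ∃ C : ℝ, ∀ (n : ℕ) (Λ : Finset (ℝ × ℝ)), Λ.card ≤ n ^ 2 →
      (∑ s ∈ Λ.image Prod.fst,
          (min n (((Finset.range n) ×ˢ (Finset.range n)).filter
            (fun x : ℕ × ℕ => ∃ l ∈ Λ, l.1 = s ∧ (x.2 : ℝ) = s * (x.1 : ℝ) + l.2)).card : ℝ)) ≤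
        C * ((n : ℝ) + 2) ^ ((7 : ℝ) / 3) :=
  ⟨5, fun n Λ hΛ => cappedSlopeSum_bound n Λ hΛ⟩

end

end Summit.ValiantsHypothesis.ValiantsHypothesis.Theorems.NewtonFramesNewtonTauWeak.CappedSlopeSum
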